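import Literature.AnabelianGeometry.SemiGraphs.FiniteEtaleCoveringGlobalDef
import Literature.AnabelianGeometry.SemiGraphs.GraphOfAnabelioidsGalois
import Literature.AnabelianGeometry.SemiGraphs.OfProfiniteGroups
import Literature.AnabelianGeometry.SemiGraphs.ZariskiMainTheorem
import Literature.AnabelianGeometry.SemiGraphs.SubdivisionLemmas
import Literature.AnabelianGeometry.Anabelioids.TerminalCoproductComponents
import Literature.AnabelianGeometry.Anabelioids.ExactFunctorProofs

/-!
# The global clause `B(𝒢′) = B(𝒢)_{/A}` is a CONDITION on `A`, not a property of every pair `(φ, A)`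
# ([SemiAnbd] Def. 2.2 (i) p. 23) — the universal closure of `Hom.IsGlobalCoveringOf` refuted

Mochizuki, *Semi-graphs of anabelioids*, Publ. RIMS **42** (2006) 221–322, §2, Definition 2.2 (i),
author's manuscript p. 23 [cite: MochizukiSemiAnbd2006, Def. 2.2(i) p.23].  Print attaches to an
OBJECT `G′` of `B(𝒢)` a semi-graph of anabelioids `𝒢′ → 𝒢` with `B(𝒢′) = B(𝒢)_{G′}`; the tree's
predicate `Hom.IsGlobalCoveringOf φ A` (`FiniteEtaleCoveringGlobalDef.lean`) types that global
clause for an ARBITRARY pair `(φ : 𝒢′ → 𝒢, A ∈ B(𝒢))`.  Its instance form at print's construction is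
a theorem (`BObj.coveringHomCan_isGlobalCoveringOf`, `CoveringGlobalProofs.lean`); this PROOF-ONLY
file records that the predicate is NOT universally valid, so that the named-fact census reads the
row as «universal closure REFUTED; instance form PROVED» (abc-iut FACT-LIST row F-1493):

* `Hom.not_isGlobalCoveringOf_initial` — for `𝒢` connected and `𝒢′` with a vertex, NO morphism
  `φ : 𝒢′ → 𝒢` is a global covering attached to the INITIAL object `∅ ∈ B(𝒢)`: `B(𝒢)_{/∅}` is a
  one-point category (every object over `∅` is initial, fibre functors detect initial objects), so
  `φ^* ≅ (∅ × −) ⋙ α` would identify `φ^*(⊤)` with `φ^*(∅)` — but through the basepoint of `B(𝒢′)`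
  at the vertex these have fibres a point and the empty set;
* `SemiGraph.bouquet_isConnected` — the bouquet `H_n` (one vertex, `n` loops; p. 16) is connected;
* `Hom.not_forall_isGlobalCoveringOf` — hence `¬ ∀ 𝒢 𝒢′ φ A, φ.IsGlobalCoveringOf A`, witnessed by
  the identity-free instance "any `φ` over the one-vertex edgeless semi-graph of anabelioids
  `B(ℤ/2)`, `A = ∅`".

Nothing here bears on [IUTchIII] Cor. 3.12; no side is taken.  No definitions, no facts.
-/

namespace Literature.AnabelianGeometry.SemiGraphs

open CategoryTheory CategoryTheory.Limits CategoryTheory.PreGaloisCategory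
open Literature.AnabelianGeometry.Anabelioids

universe v₁ u₁ u

/-! ### The bouquets are connected -/

/-- The bouquet `H_n` — one vertex `v_H`, `n` edges all running from `v_H` to `v_H` ([SemiAnbd] §1
p. 16) — is connected: every edge-point and branch-point of its barycentric subdivision is joined to
the vertex-point. [cite: MochizukiSemiAnbd2006, §1 p.16] -/
theorem SemiGraph.bouquet_isConnected (n : ℕ) : (SemiGraph.bouquet.{u} n).IsConnected := by
  classical
  have hbv : ∀ b : (SemiGraph.bouquet.{u} n).Branch,
      (SemiGraph.bouquet.{u} n).subdivision.Reachable (Sum.inr (Sum.inr b)) (Sum.inl PUnit.unit) :=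
    fun b => (SemiGraph.subdivision_adj_of_nodeRel _
      (SemiGraph.NodeRel.branch_vertex b PUnit.unit rfl)).reachable
  have hall : ∀ a : (SemiGraph.bouquet.{u} n).Node,
      (SemiGraph.bouquet.{u} n).subdivision.Reachable a (Sum.inl PUnit.unit) := by
    intro a
    rcases a with ⟨⟨⟩⟩ | e | b
    · exact SimpleGraph.Reachable.refl _
    · exact (SemiGraph.subdivision_adj_of_nodeRel _ (SemiGraph.NodeRel.edge_branch
        (⟨(e.down, false)⟩ : (SemiGraph.bouquet.{u} n).Branch))).reachable.trans (hbv _)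
    · exact hbv b
  haveI : Nonempty (SemiGraph.bouquet.{u} n).Node := ⟨Sum.inl PUnit.unit⟩
  exact ⟨⟨fun a b => (hall a).trans (hall b).symm⟩⟩

namespace SemiGraphOfAnabelioids

/-! ### No morphism is a global covering attached to the initial object -/

/-- **The global clause fails at `A = ∅`.**  For a connected semi-graph of anabelioids `𝒢` and any
`𝒢′` with a vertex `v′`, no morphism `φ : 𝒢′ → 𝒢` satisfies `B(𝒢′) = B(𝒢)_{/∅}` via `φ^*`
([SemiAnbd] Def. 2.2 (i) p. 23 attaches coverings to objects; the empty object yields the empty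
covering, which is not a semi-graph of CONNECTED anabelioids with a vertex): every object of
`B(𝒢)_{/∅}` is initial, so an equivalence `α` with `φ^* ≅ (∅ × −) ⋙ α` would give
`φ^*(⊤) ≅ φ^*(∅)`, whereas the basepoint `φ^* ⋙ ρ_{v′} ⋙ F′ = ρ_{φ v′} ⋙ (φ_{v′}^* ⋙ F′)` of `B(𝒢)`
has fibre a point at `⊤` and empty fibre at `∅`. [cite: MochizukiSemiAnbd2006, Def. 2.2(i) p.23] -/
theorem Hom.not_isGlobalCoveringOf_initial {𝒢 𝒢' : SemiGraphOfAnabelioids.{v₁, u₁, u}}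
    (h𝒢 : 𝒢.IsConnected) (φ : Hom 𝒢' 𝒢) (v' : 𝒢'.graph.Vertex) :
    letI := preGaloisCategory_bObj 𝒢
    ¬ φ.IsGlobalCoveringOf (⊥_ 𝒢.BObj) := by
  letI := preGaloisCategory_bObj 𝒢
  haveI : GaloisCategory 𝒢.BObj := galoisCategory_bObj 𝒢 h𝒢
  rintro ⟨hprod, α, hα, ⟨e⟩⟩
  -- a basepoint of `B(𝒢)` through the vertex `φ v′`, factored through `φ^*`
  let F' := GaloisCategory.getFiberFunctor (𝒢'.V v')
  haveI : FiberFunctor ((φ.φV v').pullback ⋙ F') := fiberFunctor_comp_of_exact _ F'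
  haveI hΦ : FiberFunctor (𝒢.ρ (φ.base.vertexMap v') ⋙ ((φ.φV v').pullback ⋙ F')) :=
    fiberFunctor_ρ 𝒢 h𝒢 _ _
  haveI hΦ' : FiberFunctor (φ.pullbackFunctor ⋙ (𝒢'.ρ v' ⋙ F')) := hΦ
  set Φ := φ.pullbackFunctor ⋙ (𝒢'.ρ v' ⋙ F') with hΦdef
  -- the fibre of `∅` is empty, hence so is the fibre of every object over `∅`
  have h0 : IsEmpty (Φ.obj (⊥_ 𝒢.BObj)) :=
    (initial_iff_fiber_empty Φ _).mp ⟨initialIsInitial⟩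
  have hI : ∀ U : Over (⊥_ 𝒢.BObj), Nonempty (IsInitial U.left) := fun U => by
    refine (initial_iff_fiber_empty Φ _).mpr ⟨fun x => ?_⟩
    exact h0.false ((Φ.map U.hom : Φ.obj U.left → Φ.obj (⊥_ 𝒢.BObj)) x)
  -- so `(∅ × ⊤ → ∅) ≅ (∅ × ∅ → ∅)` in `B(𝒢)_{/∅}`
  let i : (Over.star (⊥_ 𝒢.BObj)).obj (⊤_ 𝒢.BObj) ≅ (Over.star (⊥_ 𝒢.BObj)).obj (⊥_ 𝒢.BObj) :=
    Over.isoMk ((hI _).some.uniqueUpToIso (hI _).some) ((hI _).some.hom_ext _ _)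
  -- transport along `φ^* ≅ (∅ × −) ⋙ α`: `φ^* ⊤ ≅ φ^* ∅`, then take fibres at `v′`
  let j : φ.pullbackFunctor.obj (⊤_ 𝒢.BObj) ≅ φ.pullbackFunctor.obj (⊥_ 𝒢.BObj) :=
    e.app _ ≪≫ α.mapIso i ≪≫ (e.app _).symm
  let j' : Φ.obj (⊤_ 𝒢.BObj) ≅ Φ.obj (⊥_ 𝒢.BObj) := (𝒢'.ρ v' ⋙ F').mapIso j
  obtain ⟨eq⟩ := nonempty_equiv_fiber_terminal_punit Φ
  exact h0.false ((j'.hom : Φ.obj (⊤_ 𝒢.BObj) → Φ.obj (⊥_ 𝒢.BObj)) (eq.symm PUnit.unit))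

/-- **The universal closure of `Hom.IsGlobalCoveringOf` is false** (abc-iut FACT-LIST row F-1493:
the row is a PREDICATE — [SemiAnbd] Def. 2.2 (i) p. 23 asserts it for the covering CONSTRUCTED from
`A`, where it is the theorem `BObj.coveringHomCan_isGlobalCoveringOf`, not for every `(φ, A)`):
over the one-vertex edgeless semi-graph of anabelioids with constituent `B(ℤ/2)`, no morphism is a
global covering attached to `∅`. [cite: MochizukiSemiAnbd2006, Def. 2.2(i) p.23] -/
theorem Hom.not_forall_isGlobalCoveringOf :
    ¬ ∀ (𝒢 𝒢' : SemiGraphOfAnabelioids.{0, 1, 0}) (φ : Hom 𝒢' 𝒢) (A : 𝒢.BObj),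
      φ.IsGlobalCoveringOf A := by
  intro h
  let 𝔊 : SemiGraphOfGroups (SemiGraph.bouquet.{0} 0) :=
    { GV := fun _ => Multiplicative (ZMod 2)
      GE := fun _ => Multiplicative (ZMod 2)
      hom := fun _ _ _ => ContinuousMonoidHom.id _ }
  have hc : 𝔊.toAnabelioids.IsConnected := ⟨SemiGraph.bouquet_isConnected 0⟩
  obtain ⟨φ⟩ : Nonempty (Hom 𝔊.toAnabelioids 𝔊.toAnabelioids) :=
    ⟨{ base := 𝟙 _
       φV := fun _ => Anabelioids.Hom.id _
       φE := fun e => nomatch e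
       φB := fun b => nomatch b }⟩
  letI := preGaloisCategory_bObj 𝔊.toAnabelioids
  exact Hom.not_isGlobalCoveringOf_initial hc φ PUnit.unit (h _ _ φ _)

end SemiGraphOfAnabelioids

end Literature.AnabelianGeometry.SemiGraphs
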